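import Summits.ValiantsHypothesis.ValiantsHypothesis.Theorems.GrenetZeonDiagonalBound
import Summits.ValiantsHypothesis.ValiantsHypothesis.Theorems.GrenetZeonPolySizeQPAlgebraDegreeFloor
import Literature.Computability.AlgebraicComplexity.AlgDetRepr
import HarnessLib

/-!
# Crux `GrenetZeon.PolySizeQPAlgebra` (stmt-ValiantsHypothesis-8064), line `vbp-slice-dealg` —
# the DIAGONAL STRIP: products of `d` affine forms over a commutative algebra need
# `dim R ≥ C(n,k)² / C(d,k)`, so the piece holds for diagonal matrices throughout the `c = 1` box

The route's support item `DiagonalBound` (proved, `GrenetZeonDiagonal.diagonalBound_proof`) is the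
corner `m = n` of the two-parameter model: `per_n = λ(∏_{i=1}^n L_i)` forces `dim R ≥ C(n, ⌊n/2⌋)`.
The same partial-derivative count works for products of ANY number `d` of affine forms — i.e. for
DIAGONAL `d × d` matrices over `R`, equivalently (by the mechanism lemma of
`GrenetZeonAbelianizationQPCommutingProduct.lean`) for commuting affine products of length `d`:

* `longDiagonalBound` — if `per_n = λ(∏_{i<d} L_i)` coefficientwise (`L_i` affine over a
  finite-dimensional commutative `ℂ`-algebra `R`), then for every `k ≤ d`,
  `C(n,k)² ≤ C(d,k) · dim_ℂ R`.  (Order-`k` partials of the product lie in the `R`-span of the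
  `C(d,k)` sub-products of `d − k` factors — `GrenetZeonDiagonal.iterPDeriv_prod_mem_span` — while
  those of `per_n` span `C(n,k)²` dimensions, `flatteningRank_perPoly`.)  At `d = n` this is
  `DiagonalBound`; the bound is non-void exactly while `k·d ≲ n²`, i.e. the diagonal STRIP
  `d ≤ n^{2−ε}` carries superpolynomial lower bounds on `dim R`, and the method dies at `d ≈ n²`
  (where the card's "every flattening is void" takes over).
* `hasAlgDetRepr_diagonal` — a diagonal product IS a `(d, dim R)`-representation (orientation).
* `no_diagonal_repr_c_one` — **the piece `PolySizeQPAlgebra` at `c = 1` HOLDS FOR DIAGONAL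
  MATRICES**: for `n ≥ 7` there is no `per_n = λ(∏_{i<d} L_i)` with `d ≤ n + 1` and
  `dim R ≤ 2^(log₂ n + 1)` (`k = 2`: `C(n,2)² ≤ C(n+1,2) · 2n` fails from `n = 7` on).  The full
  `c = 1` box (non-diagonal `(n+1) × (n+1)` matrices over `R` of dimension `≤ 2n`) stays open — it
  contains the unit case of crux `TwoDimCoefficients`.

Honest framing: an extension of a proved support item along the diagonal; the registered stubs of
8064 (`stub_vbpSlice c`, `stub_dealgebraizePoly c`, `c ≥ 2`) are not touched and nothing here is
progress on VP ≠ VNP.  Axioms `propext`, `Classical.choice`, `Quot.sound`.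

## References
* N. Nisan, A. Wigderson, *Lower bounds on arithmetic circuits via partial derivatives*,
  Comput. Complexity 6 (1996), §2. [NisanWigderson1996]
* J. M. Landsberg, *Geometry and Complexity Theory*, CUP 2017, Exercise 6.2.2.7. [LandsbergGCT2017]
-/

set_option linter.dupNamespace false

noncomputable section

open MvPolynomial Finset

namespace Summit.ValiantsHypothesis.ValiantsHypothesis.Theorems.GrenetZeonPolySizeQPAlgebra

open Literature.Barriers.ValiantsHypothesis Literature.Computability.AlgebraicComplexity

open Summit.ValiantsHypothesis.ValiantsHypothesis.Theorems.GrenetZeonDiagonal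


/-- **The long diagonal bound.** If `per_n = λ(∏_{i<d} L_i)` coefficientwise, for affine forms
`L_i` with coefficients in a finite-dimensional commutative `ℂ`-algebra `R` and a `ℂ`-linear
`λ : R → ℂ`, then `C(n,k)² ≤ C(d,k) · dim_ℂ R` for every `k ≤ d`: the order-`k` partials of
`per_n = Λ(∏ L_i)` lie in `Λ` of the `R`-span of the `C(d, d−k) = C(d,k)` sub-products of `d − k`
factors (Leibniz on affine factors), a `ℂ`-space of dimension `≤ C(d,k) · dim R`, while they span
`C(n,k)²` dimensions (`flatteningRank_perPoly`).  `d = n`, `k = ⌊n/2⌋` is the route's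
`DiagonalBound`. [cite: NisanWigderson1996, §2] [cite: LandsbergGCT2017, Exercise 6.2.2.7] -/
theorem longDiagonalBound {n d k : ℕ} (hkd : k ≤ d) {R : Type} [CommRing R] [Algebra ℂ R]
    [Module.Finite ℂ R] (l : R →ₗ[ℂ] ℂ) (L : Fin d → MvPolynomial (Fin n × Fin n) R)
    (hL : ∀ i, (L i).totalDegree ≤ 1)
    (hcoeff : ∀ e : (Fin n × Fin n) →₀ ℕ,
      l (MvPolynomial.coeff e (∏ i, L i)) = MvPolynomial.coeff e (perPoly (Fin n) ℂ)) :
    (n.choose k) ^ 2 ≤ d.choose k * Module.finrank ℂ R := by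
  classical
  -- `Λ (∏ L i) = per_n`
  set F : MvPolynomial (Fin n × Fin n) R := ∏ i, L i with hF
  have hΛF : (AddMonoidAlgebra.map l.toAddMonoidHom F : MvPolynomial (Fin n × Fin n) ℂ) =
      perPoly (Fin n) ℂ := by
    ext e
    rw [coeff_mapL]
    exact hcoeff e
  -- the index set of `(d-k)`-subsets and the map `Ψ`
  let g : {T : Finset (Fin d) // T.card = d - k} → MvPolynomial (Fin n × Fin n) R :=
    fun T => ∏ j ∈ (T : Finset (Fin d)), L j
  have hcardι : Fintype.card {T : Finset (Fin d) // T.card = d - k} = d.choose k := by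
    rw [Fintype.card_subtype]
    have : (univ.filter fun T : Finset (Fin d) => T.card = d - k) =
        (univ : Finset (Fin d)).powersetCard (d - k) := by
      ext T
      simp [mem_powersetCard]
    rw [this, card_powersetCard, card_univ, Fintype.card_fin, Nat.choose_symm hkd]
  let Ψ : ({T : Finset (Fin d) // T.card = d - k} → R) →ₗ[ℂ] MvPolynomial (Fin n × Fin n) ℂ :=
    { toFun := fun r => ∑ T, AddMonoidAlgebra.map l.toAddMonoidHom (r T • g T)
      map_add' := fun r₁ r₂ => by
        rw [← sum_add_distrib]
        refine sum_congr rfl fun T _ => ?_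
        rw [Pi.add_apply, add_smul, mapL_add]
      map_smul' := fun c r => by
        rw [RingHom.id_apply, smul_sum]
        refine sum_congr rfl fun T _ => ?_
        rw [Pi.smul_apply, smul_assoc, mapL_smul] }
  -- every order-`k` partial of `per_n` lies in `range Ψ`
  have hsub : Submodule.span ℂ (derivSet k (perPoly (Fin n) ℂ)) ≤ LinearMap.range Ψ := by
    rw [Submodule.span_le, ← hΛF, derivSet_mapL]
    rintro _ ⟨q, ⟨li, hli, rfl⟩, rfl⟩
    have hmem := iterPDeriv_prod_mem_span L hL li (by rw [Fintype.card_fin]; omega)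
    rw [Fintype.card_fin, hli] at hmem
    have hmem' : iterPDeriv li F ∈ Submodule.span R (Set.range g) := by
      refine Submodule.span_mono ?_ hmem
      rintro q ⟨T, hT, rfl⟩
      exact ⟨⟨T, hT⟩, rfl⟩
    obtain ⟨r, hr⟩ := mapL_mem_range_of_mem_span l g hmem'
    exact ⟨r, hr.symm⟩
  -- dimension count
  have h1 : Module.finrank ℂ (Submodule.span ℂ (derivSet k (perPoly (Fin n) ℂ))) =
      (n.choose k) ^ 2 := by
    rw [← shiftedPartialsRank_zero_eq, flatteningRank_perPoly]
  have h2 : Module.finrank ℂ (LinearMap.range Ψ) ≤ d.choose k * Module.finrank ℂ R := by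
    refine (LinearMap.finrank_range_le Ψ).trans ?_
    rw [Module.finrank_pi_fintype, sum_const, card_univ, hcardι, smul_eq_mul]
  rw [← h1]
  exact (Submodule.finrank_mono hsub).trans h2

/-- Orientation: a diagonal product `λ(∏_{i<d} L_i)` over `R` with `dim R ≤ s` IS a
`(d, s)`-representation (`det (diag L) = ∏ L_i`). [cite: MignonRessayre2004, §1] -/
theorem hasAlgDetRepr_diagonal {n d s : ℕ} {R : Type} [CommRing R] [Algebra ℂ R]
    [Module.Finite ℂ R] (hR : Module.finrank ℂ R ≤ s) (l : R →ₗ[ℂ] ℂ)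
    (L : Fin d → MvPolynomial (Fin n × Fin n) R) (hL : ∀ i, (L i).totalDegree ≤ 1)
    (hcoeff : ∀ e : (Fin n × Fin n) →₀ ℕ,
      l (MvPolynomial.coeff e (∏ i, L i)) = MvPolynomial.coeff e (perPoly (Fin n) ℂ)) :
    HasAlgDetRepr (perPoly (Fin n) ℂ) d s := by
  classical
  refine HasAlgDetRepr.of_data R hR l (Matrix.diagonal L) (fun i j => ?_) (fun e => ?_)
  · rw [Matrix.diagonal_apply]
    split_ifs
    · exact hL i
    · rw [totalDegree_zero]; exact Nat.zero_le _
  · rw [Matrix.det_diagonal]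
    exact hcoeff e

/-- Degree floor for diagonal products: `per_n = λ(∏_{i<d} L_i)` forces `n ≤ d`
(`le_of_hasAlgDetRepr_perPoly`). [cite: MignonRessayre2004, §1] -/
theorem le_of_diagonal_repr {n d : ℕ} {R : Type} [CommRing R] [Algebra ℂ R]
    [Module.Finite ℂ R] (l : R →ₗ[ℂ] ℂ) (L : Fin d → MvPolynomial (Fin n × Fin n) R)
    (hL : ∀ i, (L i).totalDegree ≤ 1)
    (hcoeff : ∀ e : (Fin n × Fin n) →₀ ℕ,
      l (MvPolynomial.coeff e (∏ i, L i)) = MvPolynomial.coeff e (perPoly (Fin n) ℂ)) :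
    n ≤ d :=
  le_of_hasAlgDetRepr_perPoly (hasAlgDetRepr_diagonal le_rfl l L hL hcoeff)

/-- The `k = 2` instance in product form: `(n(n−1))² ≤ 2 · d(d−1) · dim R`, i.e.
`4·C(n,2)² ≤ 4·C(d,2)·dim R` with `2·C(m,2) = m(m−1)`. [cite: NisanWigderson1996, §2] -/
theorem longDiagonalBound_two {n d : ℕ} (hd : 2 ≤ d) {R : Type} [CommRing R] [Algebra ℂ R]
    [Module.Finite ℂ R] (l : R →ₗ[ℂ] ℂ) (L : Fin d → MvPolynomial (Fin n × Fin n) R)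
    (hL : ∀ i, (L i).totalDegree ≤ 1)
    (hcoeff : ∀ e : (Fin n × Fin n) →₀ ℕ,
      l (MvPolynomial.coeff e (∏ i, L i)) = MvPolynomial.coeff e (perPoly (Fin n) ℂ)) :
    (n * (n - 1)) ^ 2 ≤ 2 * (d * (d - 1)) * Module.finrank ℂ R := by
  have h := longDiagonalBound hd l L hL hcoeff
  have hn2 : n * (n - 1) = 2 * n.choose 2 := by
    rw [Nat.choose_two_right, Nat.mul_div_cancel' (Nat.even_mul_pred_self n).two_dvd]
  have hd2 : d * (d - 1) = 2 * d.choose 2 := by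
    rw [Nat.choose_two_right, Nat.mul_div_cancel' (Nat.even_mul_pred_self d).two_dvd]
  rw [hn2, hd2]
  nlinarith [h]

/-- **`PolySizeQPAlgebra` at `c = 1` holds for diagonal matrices.** For `n ≥ 7` there are no
affine forms `L_0, …, L_{d-1}` over a commutative `ℂ`-algebra `R` with `d ≤ n + 1`,
`dim R ≤ 2^(log₂ n + 1)` and `per_n = λ(∏ L_i)`: by `longDiagonalBound` at `k = 2`,
`(n(n−1))² ≤ 2·d(d−1)·dim R ≤ 2·(n+1)n·2n`, i.e. `(n−1)² ≤ 4(n+1)`, false from `n = 7` on.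
(The `c = 1` box of the piece is `m ≤ n + 1`, `s ≤ 2^((log₂ n + 1)^1)`; its non-diagonal part is
open.) [cite: NisanWigderson1996, §2] -/
theorem no_diagonal_repr_c_one {n d : ℕ} (hn : 7 ≤ n) (hd : d ≤ n ^ 1 + 1) {R : Type} [CommRing R]
    [Algebra ℂ R] [Module.Finite ℂ R] (hR : Module.finrank ℂ R ≤ 2 ^ ((Nat.log 2 n + 1) ^ 1))
    (l : R →ₗ[ℂ] ℂ) (L : Fin d → MvPolynomial (Fin n × Fin n) R)
    (hL : ∀ i, (L i).totalDegree ≤ 1) :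
    ¬ ∀ e : (Fin n × Fin n) →₀ ℕ,
      l (MvPolynomial.coeff e (∏ i, L i)) = MvPolynomial.coeff e (perPoly (Fin n) ℂ) := by
  intro hcoeff
  have hnd : n ≤ d := le_of_diagonal_repr l L hL hcoeff
  rw [pow_one] at hd
  rw [pow_one, pow_succ] at hR
  have hlog : 2 ^ Nat.log 2 n ≤ n := Nat.pow_log_le_self 2 (by omega)
  have hs : Module.finrank ℂ R ≤ 2 * n := by omega
  have h := longDiagonalBound_two (by omega) l L hL hcoeff
  -- `(n(n-1))² ≤ 2 d(d-1) dim R ≤ 2 (n+1) n (2n)`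
  obtain ⟨m, rfl⟩ : ∃ m, n = m + 1 := ⟨n - 1, by omega⟩
  have hd' : d * (d - 1) ≤ (m + 2) * (m + 1) := by
    have h1 : d ≤ m + 2 := by omega
    have h2 : d - 1 ≤ m + 1 := by omega
    exact Nat.mul_le_mul h1 h2
  have key : ((m + 1) * m) ^ 2 ≤ 2 * ((m + 2) * (m + 1)) * (2 * (m + 1)) := by
    calc ((m + 1) * m) ^ 2 = ((m + 1) * (m + 1 - 1)) ^ 2 := by rw [Nat.add_sub_cancel]
      _ ≤ 2 * (d * (d - 1)) * Module.finrank ℂ R := h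
      _ ≤ 2 * ((m + 2) * (m + 1)) * (2 * (m + 1)) :=
          Nat.mul_le_mul (Nat.mul_le_mul_left 2 hd') hs
  have key' : m * m ≤ 4 * (m + 2) := by
    have hpos : 0 < (m + 1) * (m + 1) := by positivity
    refine Nat.le_of_mul_le_mul_left ?_ hpos
    calc (m + 1) * (m + 1) * (m * m) = ((m + 1) * m) ^ 2 := by ring
      _ ≤ 2 * ((m + 2) * (m + 1)) * (2 * (m + 1)) := key
      _ = (m + 1) * (m + 1) * (4 * (m + 2)) := by ring
  nlinarith [key', hn]

/-- The same, in the shape of the piece `PolySizeQPAlgebra` at `c = 1` restricted to DIAGONAL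
matrices (with `n₀ = 7`). [cite: NisanWigderson1996, §2] -/
theorem polySizeQPAlgebra_one_diagonal :
    ∃ n₀ : ℕ, ∀ n ≥ n₀, ∀ d s : ℕ, d ≤ n ^ 1 + 1 → s ≤ 2 ^ ((Nat.log 2 n + 1) ^ 1) →
      ∀ (R : Type) [CommRing R] [Algebra ℂ R] [Module.Finite ℂ R], Module.finrank ℂ R ≤ s →
        ∀ (l : R →ₗ[ℂ] ℂ) (L : Fin d → MvPolynomial (Fin n × Fin n) R),
          (∀ i, (L i).totalDegree ≤ 1) →
            ¬ ∀ e : (Fin n × Fin n) →₀ ℕ,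
              l (MvPolynomial.coeff e (∏ i, L i)) = MvPolynomial.coeff e (perPoly (Fin n) ℂ) :=
  ⟨7, fun _ hn _ _ hd hs _ _ _ _ hR l L hL => no_diagonal_repr_c_one hn hd (hR.trans hs) l L hL⟩

end Summit.ValiantsHypothesis.ValiantsHypothesis.Theorems.GrenetZeonPolySizeQPAlgebra

end
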